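import Literature.Computability.Complexity.HiraharaMachineDesign
import HarnessLib

/-!
# The machine of Hirahara's reduction, IV: the main output on lists (definitions)

Topic `Computability/Complexity`. The list-level mirror of the main branch of `HiraharaRed.redOut`
— `(Pre.toPInst I₀).output ((Pre.toPInst I₀).coinsOf r)` (`HiraharaSpec.lean`,
`HiraharaInstance.lean`): the `MCSP*` instance `(table, s_P)` whose table lists, for every index
`i < 2^{Lx}`, the value `PT` of the partial function at the bit vector of `i`. Here every
ingredient is an explicit function of the instance tuple `t` and the coin string `r` on lists of
naturals and Booleans: coin lookup (`coinT`), the design positions (`eAposT`, `EposT`, through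
`lexWordsT` of part III), the amplified functions `f̂_k` (`fhatT`: seed fields, Hankel hitter,
parity of `k_A` queries), the NW outputs of the slot variables (`maskT`), the Benaloh–Leichter
shares on a coin list (`shareT`, `shareVecT`), the table value by exhaustive search over the
secret and the sharing coins (`PTvalT`), the table and the output (`tableT`, `mainOutT`). The
agreement with the specification is part V, the computation on codes part VI.

## References

* S. Hirahara, *NP-hardness of learning programs and partial MCSP*, ECCC TR22-119, proofs of
  Lemma 8.1, Lemma 8.3 and Thm. 8.5 [Hirahara2022PartialMCSP].
-/

namespace Literature.Computability.Complexity

open _root_.Computability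
open Literature.Computability.MetaComplexity (MonotoneDNF)
open CSPToCMMSAMachine (TO)

namespace HiraharaMachine

/-! ### Bits and parities -/

/-- Parity of a list of bits. [folklore] -/
def parityT (l : List Bool) : Bool := l.foldl xor false

/-- The number with binary digits `v` (least significant first). [folklore] -/
def valT : List Bool → ℕ
  | [] => 0
  | b :: v => Nat.bit b (valT v)

section Main

variable (t : TO) (r : List Bool)

/-! ### Coins -/

/-- The coin `f_k(v) = r[off k + #v]`. [cite: Hirahara2022PartialMCSP, proof of Lemma 8.3 ("pick fᵢ ∼ {0,1}^{λ w(i)}")] -/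
def coinT (k : ℕ) (v : List Bool) : Bool := r.getD (offT t (min k (nT t)) + valT v) false

/-! ### The enumeration budget -/

/-- **The enumeration budget** `(2·size + 2)^{4·4^{143}} · 2^{4096·4^{143}}`: a polynomial of the size
measure dominating `2^{4^{143} Λ}`, hence every enumeration of the reduction (design candidates,
table indices, sharing coins) on the instances of the main branch. [folklore] -/
def budgetT : ℕ := (2 * sizeOfT t + 2) ^ (4 * 4 ^ 143) * 2 ^ (4096 * 4 ^ 143)

/-! ### Design positions -/

/-- The words of the amplification design of variable `k` (alphabet `16`, length `N_k`,
agreements `≤ N_k / 2`), enumerated within the budget. [cite: Hirahara2022PartialMCSP, proof of Lemma 8.1 and Prop. 6.2] -/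
def AWT (k : ℕ) : List (List ℕ) := lexWordsCapT (budgetT t) (NT t k) 16 (NT t k / 2)

/-- Position `rr` of the `q`-th amplification block of variable `k` inside `[16 N_k]`:
`digit + 16 · rr`. [cite: Hirahara2022PartialMCSP, proof of Lemma 8.1] -/
def eAposT (k q rr : ℕ) : ℕ := ((AWT t k).getD q []).getD rr 0 + 16 * rr

/-- The words of the Nisan–Wigderson design (alphabet `4^{140}`, length `ℓ`, agreements `≤ ℓ/140`).
[cite: Hirahara2022PartialMCSP, proof of Lemma 8.3 and Prop. 6.2] -/
def EWT : List (List ℕ) := lexWordsCapT (budgetT t) (ℓT t) (4 ^ 140) (ℓT t / 140)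

/-- Position `x` of the NW block of `(k, tt)` inside `[d]`: `digit + 4^{140} · x`, the word being
the `(tt + Δ k)`-th. [cite: Hirahara2022PartialMCSP, proof of Lemma 8.3] -/
def EposT (k tt x : ℕ) : ℕ := ((EWT t).getD (tt + ΔT t * k) []).getD x 0 + 4 ^ 140 * x

/-! ### The amplified functions -/

/-- The `q`-th query input of `f̂_k` on the block `y ∈ {0,1}^ℓ`: bit `rr` is
`x_{e(q,rr)} ⊕ (Σ_{c<m, bit_c(q)} t_{rr+c} + b_{rr})`, with the seed fields `x = y[0,16N)`,
`t = y[16N, 16N+N+m)`, `b = y[16N+N+m, 16N+N+m+N)`. [cite: Hirahara2022PartialMCSP, proof of Lemma 8.1 (z_{Sᵢ} ⊕ H(r)ᵢ)] -/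
def inpT (k : ℕ) (y : List Bool) (q : ℕ) : List Bool :=
  (List.range (NT t k)).map fun rr =>
    xor (y.getD (eAposT t k q rr) false)
      (xor (parityT ((List.range (mIT t)).map fun c => q.testBit c && y.getD (NT t k * 4 ^ 2 + (rr + c)) false))
        (y.getD (NT t k * 4 ^ 2 + ((NT t k + mIT t) + rr)) false))

/-- **`f̂_k(y) = ⊕_{q < k_A} f_k(w_q(y))`.** [cite: Hirahara2022PartialMCSP, proof of Lemma 8.1 (Amp^f)] -/
def fhatT (k : ℕ) (y : List Bool) : Bool :=
  parityT ((List.range (kAT t)).map fun q => coinT t r k (inpT t k y q))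

/-- The NW block of `(k, tt)` read off the seed `z ∈ {0,1}^d`. [cite: Hirahara2022PartialMCSP, proof of Lemma 8.3 (NW^{f̂}(z))] -/
def blockT (z : List Bool) (k tt : ℕ) : List Bool := (List.range (ℓT t)).map fun x => z.getD (EposT t k tt x) false

/-! ### Slots and the mask -/

/-- The kept formula `j` (empty out of range). [folklore] -/
def φT (j : ℕ) : MonotoneDNF := (keptT t).getD j []

/-- The distinct variables of formula `j`. [cite: Hirahara2022PartialMCSP, proof of Lemma 8.3] -/
def varsT (j : ℕ) : List ℕ := ((φT t j).flatMap id).dedup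

/-- The variable of slot `s` of formula `j`, if any. [cite: Hirahara2022PartialMCSP, proof of Lemma 8.3] -/
def slotT (j s : ℕ) : Option ℕ :=
  if s < (varsT t j).length then (if (varsT t j).getD s 0 < nT t then some ((varsT t j).getD s 0) else none) else none

/-- Row `s` of the mask: the NW outputs `f̂_k(z|_{S_{(k,tt)}})`, `tt < Δ`, of the slot variable `k`
(zeros for an empty slot). [cite: Hirahara2022PartialMCSP, proof of Lemma 8.3 (NW(f̂_{v_i}; z))] -/
def maskRowT (j : ℕ) (z : List Bool) (s : ℕ) : List Bool :=
  match slotT t j s with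
  | some k => (List.range (ΔT t)).map fun tt => fhatT t r k (blockT t z k tt)
  | none => List.replicate (ΔT t) false

/-- The mask: all `Δ` rows. [cite: Hirahara2022PartialMCSP, proof of Lemma 8.3] -/
def maskT (j : ℕ) (z : List Bool) : List (List Bool) := (List.range (ΔT t)).map (maskRowT t r j z)

/-! ### Shares on a coin list -/

/-- The sharing coin `r_{k',p}` read off the coin list (index `p + L·k'`, `L` the number of
literals; `false` out of range). [cite: Hirahara2022PartialMCSP, Lemma 4.5] -/
def rbitT (φ : MonotoneDNF) (rbits : List Bool) (k' p : ℕ) : Bool :=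
  if k' < φ.length ∧ p < φ.numLiterals then rbits.getD (p + φ.numLiterals * k') false else false

/-- The share symbol at occurrence `(k', p)` as a bit: `b ⊕ ⊕_{1 ≤ p' < |term|} r_{k',p'}` at
position `0`, the coin `r_{k',p}` elsewhere. [cite: Hirahara2022PartialMCSP, Lemma 4.5] -/
def symbolT (φ : MonotoneDNF) (b : Bool) (rbits : List Bool) (kp : ℕ × ℕ) : Bool :=
  if kp.2 = 0 then xor b (parityT (((List.range (φ.termLen kp.1)).filter fun p => decide (1 ≤ p)).map (rbitT φ rbits kp.1)))
  else rbitT φ rbits kp.1 kp.2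

/-- The share of party `i`. [cite: Hirahara2022PartialMCSP, Lemma 4.5] -/
def shareT (φ : MonotoneDNF) (b : Bool) (rbits : List Bool) (i : ℕ) : List Bool := (φ.occsOf i).map (symbolT φ b rbits)

/-- The slotted, padded share vector (rows of `Δ` bits). [cite: Hirahara2022PartialMCSP, proof of Lemma 8.3 (sᵢ ∈ {0,1}^Δ)] -/
def shareVecT (j : ℕ) (b : Bool) (rbits : List Bool) : List (List Bool) :=
  (List.range (ΔT t)).map fun s =>
    match slotT t j s with
    | some k => (List.range (ΔT t)).map fun tt => (shareT (φT t j) b rbits k).getD tt false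
    | none => List.replicate (ΔT t) false

/-- All bit lists of length `L` (the `L`-digit binary expansions of `0, …, 2^L - 1`), enumerated
within a budget `u`. [folklore] -/
def allBitsT (u L : ℕ) : List (List Bool) := (List.range (min (2 ^ L) u)).map fun i => (List.range L).map fun p => i.testBit p

/-- The number of sharing coins of formula `j`. [folklore] -/
def nCoinsT (j : ℕ) : ℕ := (φT t j).length * (φT t j).numLiterals

/-! ### The table -/

/-- Row-wise XOR of two matrices. [folklore] -/
def xorRowsT (a c : List (List Bool)) : List (List Bool) := List.zipWith (fun u v => List.zipWith xor u v) a c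

/-- The fields of a table index `i < 2^{Lx}`: `(j, z, ξ)` with `j` the number on the first `Lj`
bits, `z` the next `d` bits, `ξ` the `Δ × Δ` slot bits. [cite: Hirahara2022PartialMCSP, proof of Lemma 8.3 (x = (j, z, ξ))] -/
def jOfT (i : ℕ) : ℕ := i % 2 ^ LjT t

/-- The NW seed field. [folklore] -/
def zOfT (i : ℕ) : List Bool := (List.range (dNWT t)).map fun q => i.testBit (LjT t + q)

/-- The slot field. [folklore] -/
def ξOfT (i : ℕ) : List (List Bool) :=
  (List.range (ΔT t)).map fun s => (List.range (ΔT t)).map fun tt => i.testBit (LjT t + (dNWT t + (tt + ΔT t * s)))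

/-- Is there a sharing coin list producing the target share vector? [cite: Hirahara2022PartialMCSP, proof of Thm. 8.5 ((x, b) ∈ supp E_k)] -/
def hasShareT (j : ℕ) (b : Bool) (target : List (List Bool)) : Bool :=
  (allBitsT (budgetT t) (nCoinsT t j)).any fun rbits => decide (shareVecT t j b rbits = target)

/-- **The table value at index `i`**: `b` if the index is a sample point of secret `b`, `*` otherwise.
[cite: Hirahara2022PartialMCSP, proof of Thm. 8.5 (MCSP* case: f(x) := b if (x, b) ∈ supp(E_k), * otherwise)] -/
def PTvalT (i : ℕ) : Option Bool :=
  if jOfT t i < νT t then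
    (if hasShareT t (jOfT t i) true (xorRowsT (ξOfT t i) (maskT t r (jOfT t i) (zOfT t i))) then some true
     else if hasShareT t (jOfT t i) false (xorRowsT (ξOfT t i) (maskT t r (jOfT t i) (zOfT t i))) then some false
     else none)
  else none

/-- The table. [cite: Hirahara2022PartialMCSP, proof of Thm. 8.5] -/
def tableT : List (Option Bool) := (List.range (min (2 ^ LxT t) (budgetT t))).map (PTvalT t r)

/-- The code of an optional bit. [folklore] -/
def optE : Option Bool → List Bool := (encodingBoolBool.optionBool).encode

/-- **The main output** `(table, s_P)`. [cite: Hirahara2022PartialMCSP, proof of Thm. 8.5 (output (f, s_P))] -/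
def mainOutT : List Bool := boolPair (CodeFP.listE optE (tableT t r)) (encodeNat (sPT t))

end Main

end HiraharaMachine

end Literature.Computability.Complexity
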